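import Literature.Algebra.Homology.CoinducedModuleRecognition
import Literature.Algebra.Homology.GroupCohomologyPi
import Mathlib.RepresentationTheory.Homological.GroupCohomology.Shapiro
import Mathlib.GroupTheory.GroupAction.Quotient
import HarnessLib

/-!
# The dual `Hom(ℤ[β], X)` of a permutation module with uniform isotropy is co-induced
# (Brown III (5.8)); hence `Hⁿ(H, Hom(ℤ[β], X)) ≅ ∏ Hⁿ(K₀, X)` vanishes when `Hⁿ(K₀, X)` does

Topic `Algebra/Homology`; namespace `Literature.Algebra.Homology.PermutationDual`.  Definitions with bodies
and theorems on Mathlib's `Rep` / `groupCohomology`; no named fact, no instance, no `sorry`.  Sequel of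
`CoinducedModuleRecognition` (Brown III (5.8): `corecognitionIso`) and `GroupCohomologyPi`
(`Hⁿ(G, ∏ Aᵢ) ≅ ∏ Hⁿ(G, Aᵢ)`), with Mathlib's Shapiro lemma `groupCohomology.coindIso`.

THE MATHEMATICS.  Let `H` be a group, `β` an `H`-set all of whose isotropy groups are ONE normal
subgroup `K₀ ⊴ H` (e.g. `β = G` a group on which `H` acts through a homomorphism `π : H → G` by
left translation: every isotropy group is `ker π`), and `X` an `H`-module.  The module of functions
`β → X` with the diagonal ("conjugation") action `(h·f)(b) = h·f(h⁻¹b)` — this is `Hom_ℤ(ℤ[β], X)`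
with its usual `H`-action, `ihomIso` — decomposes along `β ≃ H/K₀ × Ω` (`Ω` = the orbit set,
`(c, ω) ↦ c·s(ω)` for a section `s`) as `Coind_{K₀}^H (∏_Ω Res X)` (Brown, *Cohomology of Groups*
III (5.8) with `I = H/K₀`, `π_c(f) = (f(c·s ω))_ω`): `funRepIsoCoind`.  Consequently (Shapiro +
cohomology commutes with products) **`Hⁿ(H, β → X) = 0` as soon as `Hⁿ(K₀, Res X) = 0`**
(`isZero_groupCohomology_funRep`, `isZero_groupCohomology_ihom`).

USE (Route A of crux `stmt-BirchSwinnertonDyer-19295`, cell `bsd-schneider-ideate`, door-c6 gen 16, the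
"presentation road" to Milne I Lemma 4.13): with `P = Inf ℤ[Gal(E₀/K)]ⁿ` door-c4's free presentation
module, `Hom(P, X_E)` at a Galois layer `E ⊇ E₀` is this module for `H = Gal(E/K)`,
`β = Fin n × Gal(E₀/K)`, `K₀ = Gal(E/E₀)`; so `H¹(Gal(E/K), Hom(P, E^×)) = 0` (Hilbert 90 at `E/E₀`),
`H¹(Gal(E/K), Hom(P, J_E)) = 0` (idèle Hilbert 90), and locally, for a decomposition group `D ≤ G`
acting on `G`, `K₀ = 1`: `H¹(D, Hom(ℤ[G]ⁿ, E_wˣ)) = 0`.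
HONEST FRAMING: finite-group module theory only; no arithmetic statement is proved here.

## References
* K. S. Brown, *Cohomology of Groups*, GTM 87 (1982), III §5 Prop. (5.8), (5.9), III §6 Prop. (6.2)
  (Shapiro), VIII §4. [Brown1982CohomologyGroups]
* J.-P. Serre, *Local Fields*, GTM 67 (1979), VII §5 (induced modules have trivial cohomology).
  [SerreLocalFields1979]
-/

noncomputable section

universe u

namespace Literature.Algebra.Homology

namespace PermutationDual

open CategoryTheory CategoryTheory.Limits groupCohomology

variable {k : Type u} [CommRing k] {H : Type u} [Group H] (X : Rep.{u} k H) (β : Type u) [MulAction H β]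

/-! ## §1 The module of functions `β → X` with the diagonal action -/

/-- **The `H`-module of functions `β → X`**, `(h·f)(b) = h·f(h⁻¹·b)` (= `Hom_ℤ(ℤ[β], X)` with its
conjugation action, cf. `ihomIso`). [cite: Brown1982CohomologyGroups, III §5] -/
def funRepr : Representation k H (β → X.V) where
  toFun h := LinearMap.pi fun b => X.ρ h ∘ₗ LinearMap.proj (h⁻¹ • b)
  map_one' := by
    ext f b
    simp
  map_mul' g h := by
    ext f b
    simp [mul_smul, map_mul]

/-- Unfolding: `(h·f)(b) = h·f(h⁻¹·b)`. [cite: Brown1982CohomologyGroups, III §5] -/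
@[simp] theorem funRepr_apply (h : H) (f : β → X.V) (b : β) :
    funRepr X β h f b = X.ρ h (f (h⁻¹ • b)) := rfl

/-- The `H`-module of functions `β → X` as an object of `Rep k H`. [cite: Brown1982CohomologyGroups, III §5] -/
abbrev funRep : Rep k H := Rep.of (funRepr X β)

/-! ## §2 `Hom(A, X) ≅ (β → X)` for a permutation module `A` with permuted basis indexed by `β` -/

section Ihom

variable {β} {A : Rep k H} (e : Module.Basis β k A.V) (he : ∀ (h : H) (i : β), A.ρ h (e i) = e (h • i))

/-- Restriction of homomorphisms to a basis: `Hom_k(A, X) ≃ₗ (β → X)`. [cite: Brown1982CohomologyGroups, III §5] -/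
def restrictBasis : (A.V →ₗ[k] X.V) ≃ₗ[k] (β → X.V) where
  toFun F b := F (e b)
  map_add' F F' := rfl
  map_smul' r F := rfl
  invFun f := e.constr k f
  left_inv F := e.ext fun i => by simp
  right_inv f := funext fun b => by simp

omit [MulAction H β] in
/-- Unfolding. [cite: Brown1982CohomologyGroups, III §5] -/
@[simp] theorem restrictBasis_apply (F : A.V →ₗ[k] X.V) (b : β) : restrictBasis X e F b = F (e b) := rfl

include he in
/-- The inverse of a permuted basis vector: `h⁻¹·e(i) = e(h⁻¹·i)`. [cite: Brown1982CohomologyGroups, III §5] -/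
theorem basis_inv (h : H) (i : β) : A.ρ h⁻¹ (e i) = e (h⁻¹ • i) := he h⁻¹ i

/-- **`Hom_k(A, X) ≅ (β → X)` as `H`-modules** for `A` with a basis `e` PERMUTED by `H`
(`h·e(i) = e(h·i)`): Mathlib's internal hom `(Rep.ihom A).obj X` (action `h F = h ∘ F ∘ h⁻¹`) is the
function module with the diagonal action. [cite: Brown1982CohomologyGroups, III §5] -/
def ihomIso : (Rep.ihom A).obj X ≅ funRep X β :=
  Rep.mkIso (Representation.Equiv.mk (restrictBasis X e) fun h => LinearMap.ext fun F => funext fun b => by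
    change (X.ρ h ∘ₗ F ∘ₗ A.ρ h⁻¹) (e b) = X.ρ h (F (e (h⁻¹ • b)))
    rw [LinearMap.comp_apply, LinearMap.comp_apply, basis_inv e he])

/-- Unfolding: `ihomIso F = (F (e b))_b`. [cite: Brown1982CohomologyGroups, III §5] -/
@[simp] theorem ihomIso_hom_hom_apply (F : ((Rep.ihom A).obj X).V) (b : β) :
    ((ihomIso X e he).hom.hom F : β → X.V) b = (show A.V →ₗ[k] X.V from F) (e b) := rfl

end Ihom

/-! ## §3 Uniform isotropy `K₀ ⊴ H`: `(β → X) ≅ Coind_{K₀}^H (∏_Ω Res X)` (Brown III (5.8)) -/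

section Coind

variable {β} (K₀ : Subgroup H)

/-- The orbit set `Ω = β / H`. [cite: Brown1982CohomologyGroups, III §5 Prop. (5.8)] -/
abbrev Orbits (H β : Type u) [Group H] [MulAction H β] : Type u := MulAction.orbitRel.Quotient H β

/-- `K₀` fixes every point of `β`. [cite: Brown1982CohomologyGroups, III §5 Prop. (5.8)] -/
theorem smul_eq_self_of_mem (hstab : ∀ b : β, MulAction.stabilizer H b = K₀) {x : H} (hx : x ∈ K₀) (b : β) : x • b = b := by
  rw [← hstab b] at hx
  exact MulAction.mem_stabilizer_iff.mp hx

/-- The parametrisation `H/K₀ × Ω → β`, `(c, ω) ↦ c̃ · s(ω)` (chosen representatives `c̃ = c.out`,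
`s(ω) = ω.out`). [cite: Brown1982CohomologyGroups, III §5 Prop. (5.8)] -/
def theta (p : (H ⧸ K₀) × Orbits H β) : β := p.1.out • p.2.out

/-- `(g·c)~ · b = g · (c̃ · b)`: the representatives of `g·c` and `g c̃` differ by an element of `K₀`,
which acts trivially. [cite: Brown1982CohomologyGroups, III §5 Prop. (5.8)] -/
theorem out_smul_smul (hstab : ∀ b : β, MulAction.stabilizer H b = K₀) (g : H) (c : H ⧸ K₀) (b : β) : (g • c).out • b = g • (c.out • b) := by
  have hc : g • c = ((g * c.out : H) : H ⧸ K₀) := by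
    conv_lhs => rw [← QuotientGroup.out_eq' c]
    rfl
  obtain ⟨κ, hκ⟩ := QuotientGroup.mk_out_eq_mul K₀ (g * c.out)
  rw [hc, hκ, mul_smul, mul_smul, smul_eq_self_of_mem K₀ hstab κ.2]

/-- `c̃ · s(ω)` lies in the orbit `ω`. [cite: Brown1982CohomologyGroups, III §5 Prop. (5.8)] -/
theorem mk_theta (p : (H ⧸ K₀) × Orbits H β) :
    (Quotient.mk'' (theta K₀ p) : Orbits H β) = p.2 := by
  rw [← MulAction.orbitRel.Quotient.mem_orbit,
    MulAction.orbitRel.Quotient.orbit_eq_orbit_out p.2 Quotient.out_eq']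
  exact MulAction.mem_orbit _ _

/-- `(c, ω) ↦ c̃ · s(ω)` is injective. [cite: Brown1982CohomologyGroups, III §5 Prop. (5.8)] -/
theorem theta_injective (hstab : ∀ b : β, MulAction.stabilizer H b = K₀) : Function.Injective (theta K₀ (H := H) (β := β)) := by
  rintro ⟨c, ω⟩ ⟨c', ω'⟩ h
  have h1 := mk_theta K₀ (c, ω)
  have h2 := mk_theta K₀ (c', ω')
  simp only at h1 h2
  have hω : ω = ω' := by rw [← h1, ← h2, h]
  subst hω
  have h' : c.out • ω.out = c'.out • ω.out := h
  have hmem : c.out⁻¹ * c'.out ∈ MulAction.stabilizer H ω.out := by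
    rw [MulAction.mem_stabilizer_iff, mul_smul, ← h', inv_smul_smul]
  rw [hstab] at hmem
  have hc : c = c' := by
    rw [← QuotientGroup.out_eq' c, ← QuotientGroup.out_eq' c']
    exact QuotientGroup.eq.mpr hmem
  rw [hc]

/-- `(c, ω) ↦ c̃ · s(ω)` is surjective. [cite: Brown1982CohomologyGroups, III §5 Prop. (5.8)] -/
theorem theta_surjective (hstab : ∀ b : β, MulAction.stabilizer H b = K₀) : Function.Surjective (theta K₀ (H := H) (β := β)) := by
  intro b
  set ω : Orbits H β := Quotient.mk'' b
  have hb : b ∈ MulAction.orbit H ω.out := by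
    rw [← MulAction.orbitRel.Quotient.orbit_eq_orbit_out ω Quotient.out_eq',
      MulAction.orbitRel.Quotient.mem_orbit]
  obtain ⟨h, hh⟩ := MulAction.mem_orbit_iff.mp hb
  obtain ⟨κ, hκ⟩ := QuotientGroup.mk_out_eq_mul K₀ h
  refine ⟨((h : H ⧸ K₀), ω), ?_⟩
  change ((h : H) : H ⧸ K₀).out • ω.out = b
  rw [hκ, mul_smul, smul_eq_self_of_mem K₀ hstab κ.2, hh]

/-- The bijection `H/K₀ × Ω ≃ β`. [cite: Brown1982CohomologyGroups, III §5 Prop. (5.8)] -/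
def thetaEquiv (hstab : ∀ b : β, MulAction.stabilizer H b = K₀) : (H ⧸ K₀) × Orbits H β ≃ β :=
  Equiv.ofBijective (theta K₀) ⟨theta_injective K₀ hstab, theta_surjective K₀ hstab⟩

/-- Brown's projections `π_c : (β → X) → (Ω → X)`, `π_c(f)(ω) = f(c̃ · s ω)`, indexed by `c ∈ H/K₀`.
[cite: Brown1982CohomologyGroups, III §5 Prop. (5.8)] -/
def proj (c : H ⧸ K₀) : (β → X.V) →ₗ[k] (Orbits H β → X.V) :=
  LinearMap.pi fun ω => LinearMap.proj (theta K₀ (c, ω))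

/-- Unfolding. [cite: Brown1982CohomologyGroups, III §5 Prop. (5.8)] -/
@[simp] theorem proj_apply (c : H ⧸ K₀) (f : β → X.V) (ω : Orbits H β) :
    proj X K₀ c f ω = f (c.out • ω.out) := rfl

/-- `π_{g c}(g f) = g ∘ π_c(f)`. [cite: Brown1982CohomologyGroups, III §5 Prop. (5.8)] -/
theorem proj_smul_apply (hstab : ∀ b : β, MulAction.stabilizer H b = K₀) (g : H) (c : H ⧸ K₀) (f : β → X.V) (ω : Orbits H β) :
    proj X K₀ (g • c) (funRepr X β g f) ω = X.ρ g (proj X K₀ c f ω) := by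
  rw [proj_apply, funRepr_apply, out_smul_smul K₀ hstab, inv_smul_smul, proj_apply]

/-- Brown's hypothesis `π_c g ∼ π_{g c}`: `ker (π_{g c} ∘ g) = ker π_c`.
[cite: Brown1982CohomologyGroups, III §5 Prop. (5.8)] -/
theorem ker_proj_comp (hstab : ∀ b : β, MulAction.stabilizer H b = K₀) (g : H) (c : H ⧸ K₀) :
    LinearMap.ker (proj X K₀ (g • c) ∘ₗ funRepr X β g) = LinearMap.ker (proj X K₀ c) := by
  ext f
  simp only [LinearMap.mem_ker, LinearMap.comp_apply, funext_iff, Pi.zero_apply]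
  refine forall_congr' fun ω => ?_
  rw [proj_smul_apply X K₀ hstab]
  constructor
  · intro h0
    have := congrArg (X.ρ g⁻¹) h0
    rwa [map_zero, ← Module.End.mul_apply, ← map_mul, inv_mul_cancel, map_one,
      Module.End.one_apply] at this
  · intro h0
    rw [h0, map_zero]

/-- The joint map `(β → X) → (H/K₀ → Ω → X)` is bijective ("direct product decomposition").
[cite: Brown1982CohomologyGroups, III §5 Prop. (5.8)] -/
theorem pi_proj_bijective (hstab : ∀ b : β, MulAction.stabilizer H b = K₀) : Function.Bijective (LinearMap.pi (proj X K₀ (β := β))) := by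
  constructor
  · intro f f' hff'
    funext b
    obtain ⟨⟨c, ω⟩, rfl⟩ := theta_surjective K₀ hstab b
    exact congr_fun (congr_fun hff' c) ω
  · intro F
    refine ⟨fun b => F ((thetaEquiv K₀ hstab).symm b).1 ((thetaEquiv K₀ hstab).symm b).2, ?_⟩
    funext c ω
    change F ((thetaEquiv K₀ hstab).symm (thetaEquiv K₀ hstab (c, ω))).1
      ((thetaEquiv K₀ hstab).symm (thetaEquiv K₀ hstab (c, ω))).2 = F c ω
    rw [Equiv.symm_apply_apply]

/-- The base point `1 · K₀ ∈ H/K₀`. [cite: Brown1982CohomologyGroups, III §5 Prop. (5.8)] -/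
abbrev basePt : H ⧸ K₀ := ((1 : H) : H ⧸ K₀)

/-- `π_{K₀}` is onto. [cite: Brown1982CohomologyGroups, III §5 Prop. (5.8)] -/
theorem proj_basePt_surjective (hstab : ∀ b : β, MulAction.stabilizer H b = K₀) : Function.Surjective (proj X K₀ (β := β) (basePt K₀)) :=
  CoinducedModule.surjective_of_bijective_pi (proj X K₀ (β := β)) (pi_proj_bijective X K₀ hstab) (basePt K₀)

/-- The `K₀`-module structure on `Ω → X` inherited from `β → X` (Brown's "`M` inherits an `H`-module
structure"), here with `H = stabilizer of K₀ ∈ H/K₀`. [cite: Brown1982CohomologyGroups, III §5 Prop. (5.8)] -/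
abbrev costab (hstab : ∀ b : β, MulAction.stabilizer H b = K₀) : Representation k (MulAction.stabilizer H (basePt K₀)) (Orbits H β → X.V) :=
  CoinducedModule.costabilizerRep (funRepr X β) (proj X K₀) (basePt K₀)
    (proj_basePt_surjective X K₀ hstab) (ker_proj_comp X K₀ hstab)

/-- **Brown III (5.8) for `β → X`: `(β → X) ≅ Coind_{K₀}^H (Ω → X)`** (the isotropy group of
`K₀ ∈ H/K₀` is `K₀`, `MulAction.stabilizer_quotient`). [cite: Brown1982CohomologyGroups, III §5 Prop. (5.8)] -/
def funRepIsoCoind (hstab : ∀ b : β, MulAction.stabilizer H b = K₀) :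
    funRep X β ≅ Rep.coind (MulAction.stabilizer H (basePt K₀)).subtype (Rep.of (costab X K₀ hstab)) :=
  CoinducedModule.corecognitionIso (funRepr X β) (proj X K₀) (basePt K₀)
    (proj_basePt_surjective X K₀ hstab) (ker_proj_comp X K₀ hstab) (pi_proj_bijective X K₀ hstab)

/-- The inherited action on `Ω → X` IS the diagonal action of `K₀` (restricted from `X`):
`(s·F)(ω) = s·F(ω)`. [cite: Brown1982CohomologyGroups, III §5 Prop. (5.8)] -/
theorem costab_apply (hstab : ∀ b : β, MulAction.stabilizer H b = K₀) (s : MulAction.stabilizer H (basePt K₀)) (F : Orbits H β → X.V) (ω : Orbits H β) :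
    costab X K₀ hstab s F ω = X.ρ (s : H) (F ω) := by
  obtain ⟨f, rfl⟩ := proj_basePt_surjective X K₀ hstab F
  rw [CoinducedModule.costabilizerRep_proj, proj_apply, proj_apply, funRepr_apply]
  have hs : (s : H) ∈ K₀ := (MulAction.stabilizer_quotient K₀).le s.2
  have h1 : (basePt K₀ (H := H)).out ∈ K₀ := by
    obtain ⟨κ, hκ⟩ := QuotientGroup.mk_out_eq_mul K₀ (1 : H)
    change (QuotientGroup.mk (1 : H) : H ⧸ K₀).out ∈ K₀
    rw [hκ, one_mul]
    exact κ.2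
  rw [smul_eq_self_of_mem K₀ hstab h1, smul_eq_self_of_mem K₀ hstab (K₀.inv_mem hs)]

/-- The coefficient module identified: `Rep.of costab ≅ ∏_Ω Res_{K₀} X` (as representations of the
isotropy group). [cite: Brown1982CohomologyGroups, III §5 Prop. (5.8), VIII §4] -/
def costabIsoPi (hstab : ∀ b : β, MulAction.stabilizer H b = K₀) :
    Rep.of (costab X K₀ hstab) ≅
      GroupCohomologyPi.piRep (fun _ : Orbits H β =>
        Rep.res (MulAction.stabilizer H (basePt K₀)).subtype X) :=
  Rep.mkIso (Representation.Equiv.mk (LinearEquiv.refl k _) fun s => LinearMap.ext fun F =>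
    funext fun ω => by
      change costab X K₀ hstab s F ω = X.ρ (s : H) (F ω)
      exact costab_apply X K₀ hstab s F ω)

/-! ## §4 Cohomology: `Hⁿ(H, β → X) = 0` when `Hⁿ(K₀, Res X) = 0` -/

/-- `Hⁿ` of the restriction to the isotropy group of `K₀ ∈ H/K₀` is `Hⁿ` of the restriction to `K₀`
(the two subgroups coincide). [cite: Brown1982CohomologyGroups, III §6 Prop. (6.2)] -/
def resStabilizerIso (n : ℕ) :
    groupCohomology (Rep.res K₀.subtype X) n ≅
      groupCohomology (Rep.res (MulAction.stabilizer H (basePt K₀)).subtype X) n :=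
  groupCohomology.mapIso (MulEquiv.subgroupCongr (MulAction.stabilizer_quotient K₀).symm)
    (LinearEquiv.refl k _) (fun _ => rfl) n

/-- **`Hⁿ(H, β → X) = 0` whenever `Hⁿ(K₀, Res_{K₀} X) = 0`** (`β` an `H`-set with all isotropy
groups equal to one subgroup `K₀`): `β → X` is co-induced from `∏_Ω Res X` (Brown III (5.8)),
Shapiro's lemma, and `Hⁿ(K₀, ∏_Ω Res X) ≅ ∏_Ω Hⁿ(K₀, Res X)`.
[cite: Brown1982CohomologyGroups, III §5 Prop. (5.8), III §6 Prop. (6.2), VIII §4] -/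
theorem isZero_groupCohomology_funRep (hstab : ∀ b : β, MulAction.stabilizer H b = K₀) (n : ℕ) (hX : IsZero (groupCohomology (Rep.res K₀.subtype X) n)) :
    IsZero (groupCohomology (funRep X β) n) := by
  refine IsZero.of_iso ?_ (((groupCohomology.functor k H n).mapIso (funRepIsoCoind X K₀ hstab)) ≪≫
    groupCohomology.coindIso (Rep.of (costab X K₀ hstab)) n ≪≫
    (groupCohomology.functor k _ n).mapIso (costabIsoPi X K₀ hstab))
  rw [groupCohomology.functor_obj, GroupCohomologyPi.isZero_groupCohomology_piRep_iff]
  intro _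
  exact hX.of_iso (resStabilizerIso X K₀ n).symm

/-- **`Hⁿ(H, Hom(A, X)) = 0` whenever `Hⁿ(K₀, Res_{K₀} X) = 0`**, for a permutation module `A` with
a basis permuted by `H` all of whose isotropy groups equal `K₀` (e.g. `A = ℤ[G]ⁿ` with `H` acting
through `π : H → G`, `K₀ = ker π`). [cite: Brown1982CohomologyGroups, III §5 Prop. (5.8), III §6 Prop. (6.2)][cite: SerreLocalFields1979, VII §5] -/
theorem isZero_groupCohomology_ihom (hstab : ∀ b : β, MulAction.stabilizer H b = K₀) {A : Rep k H} (e : Module.Basis β k A.V)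
    (he : ∀ (h : H) (i : β), A.ρ h (e i) = e (h • i)) (n : ℕ)
    (hX : IsZero (groupCohomology (Rep.res K₀.subtype X) n)) :
    IsZero (groupCohomology ((Rep.ihom A).obj X) n) :=
  (isZero_groupCohomology_funRep X K₀ hstab n hX).of_iso
    ((groupCohomology.functor k H n).mapIso (ihomIso X e he))

end Coind

end PermutationDual

end Literature.Algebra.Homology

end
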